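import Mathlib
import Literature.MathematicalPhysics.MHD.BallooningSAlphaStableSide
import HarnessLib

/-!
# The `s–α` energy of a FIXED trial function is a convex quadratic polynomial in the pressure-gradient parameter
# `α`; hence the set of `α` at which a given trial function is an instability witness is an INTERVAL — two certified
# unstable points with the same trial function certify the whole band between them

Topic `Literature/MathematicalPhysics/MHD` (namespace = path; sub-namespace `Ballooning.SAlpha`, the one of
`BallooningSAlpha.lean` / `BallooningSAlphaStableSide.lean`, used BY IMPORT).  Written for the venture ladder GRIDFUSION,
rung F3 (the `s–α` first-stability boundary), by gridfusion-lit-3 (g14), 2026-08-28.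

## What is typed and PROVED (no named facts)
For the `s–α` functional `W[X; a, b](s, α) = ∫ₐᵇ [(1 + Λ²)X′² − α(Λ sin θ + cos θ)X²] dθ`, `Λ = sθ − α sin θ`
(Freidberg (12.38) reduced with (12.96)–(12.97)), the dependence on the two surface parameters for a FIXED trial
function is polynomial — the structure behind every «analytic ballooning estimate with a simple trial function», e.g.
Fundamenski's `X = 1 + cos θ` on `(−π, π)` giving «`W ≈ 1.39s² − 2.17sα + α² − α + 0.5`» and the marginal curve
(4.159).  Precisely, in `α` at fixed `s`:
* `energyDensity_convexComb` (PROVED, a ring identity): the density at `α = (1 − t)α₁ + tα₂` equals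
  `(1 − t)·density(α₁) + t·density(α₂) − t(1 − t)(α₁ − α₂)²·sin²θ·(X′² + X²)` — a QUADRATIC in `α` with the
  NON-NEGATIVE leading coefficient `sin²θ (X′(θ)² + X(θ)²)` (from `α² sin²θ` in `Λ²` and `+α² sin²θ` in the drive);
* `energy_le_convexComb` (PROVED): for an admissible `X` (differentiable on `[a, b]`, `X′ ∈ L²`) the energy is a
  CONVEX function of `α`: `W((1 − t)α₁ + tα₂) ≤ (1 − t)W(α₁) + tW(α₂)` for `t ∈ [0, 1]`;
* ★ `unstableWitness_between` (PROVED): if the SAME `(X, X′)` is an `UnstableWitness` on `[a, b]` at `α₁` and at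
  `α₂`, it is one at every `α ∈ [α₁, α₂]` — the witness set of a trial function in `α` is an interval.  So two
  kernel certificates (e.g. two runs of the finite-element lane of `BallooningSAlphaSplineWitness.lean` with the same
  pieces at two values of `α`) certify the instability of a whole BAND of surfaces `{s} × [α₁, α₂]` in the model.
* §2: the SAME in the shear direction at fixed `α` (`energyDensity_convexComb_shear`: leading coefficient `θ²X′²`;
  `energy_le_convexComb_shear`; ★ `unstableWitness_between_shear`): witness sets are intervals in `s`, so two
  certificates with one trial function give a statement uniform in `s` on an interval (NOT jointly in `(s, α)`: the
  mixed term `−αsθ sin θ X²` makes the form indefinite off the axes).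
Nothing is claimed about the stable side (an intersection over all `X` of complements of intervals — the first AND
the second region of stability of the diagram are both compatible with this structure).

## THREE COLUMNS
CERTIFIED (by users): bands `[α₁, α₂] ⊆ U_s` of the unstable set of the MODEL at a shear `s` from two point
certificates with one trial function.  VALIDATED: nothing numerical here; Fundamenski's decimals (4.158) are a
juxtaposed print instance of the quadratic structure, not used.  MODELLED: the `s–α` model; «unstable» in the model's
one-surface (Newcomb) sense; representation step quoted (`BallooningSAlpha.lean`); nothing about a device.

## Sources
* J. P. Freidberg, *Ideal MHD*, CUP 2014 [Freidberg2014]: §12.3 eq. (12.38), §12.6.2 eqs. (12.96)–(12.97)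
  [galaxy:panama:388488381857833 p0474–p0475, p0488].
* W. Fundamenski, *Power Exhaust in Fusion Plasmas*, CUP 2009 [Fundamenski2009]: §4 eqs. (4.154)–(4.159) (the `s–α`
  functional and the analytic trial-function estimate quadratic in `(s, α)`) [corpus: book:fundamenski2009-power-exhaust-fusion-plasmas
  p0170 L1–L27].
-/

noncomputable section

open Real MeasureTheory intervalIntegral Set

namespace Literature.MathematicalPhysics.MHD

namespace Ballooning

namespace SAlpha

/-- THE `s–α` ENERGY DENSITY IS A CONVEX QUADRATIC IN `α` (ring identity): at `α = (1 − t)α₁ + tα₂`,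
`density(α) = (1 − t)·density(α₁) + t·density(α₂) − t(1 − t)(α₁ − α₂)²·sin²θ·(X′² + X²)`; the leading coefficient
`sin²θ (X′² + X²)` of the quadratic comes from `α² sin²θ X′²` in `(1 + Λ²)X′²` and `+α² sin²θ X²` in `−α(Λ sin θ + cos θ)X²`.
[cite: Freidberg2014, §12.6.2 eq. (12.97)] (structure of its quadratic form; cf. [Fundamenski2009] eq. (4.158)) -/
theorem energyDensity_convexComb (s α₁ α₂ t : ℝ) (X X' : ℝ → ℝ) (θ : ℝ) :
    energyDensity s ((1 - t) * α₁ + t * α₂) X X' θ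
      = (1 - t) * energyDensity s α₁ X X' θ + t * energyDensity s α₂ X X' θ
        - t * (1 - t) * (α₁ - α₂) ^ 2 * (Real.sin θ ^ 2 * (X' θ ^ 2 + X θ ^ 2)) := by
  unfold energyDensity bending drive shearParam
  ring

/-- [folklore] Continuity of a trial function differentiable on `[a, b]`. -/
private theorem continuousOn_of_hasDerivAt'' {X X' : ℝ → ℝ} {a b : ℝ}
    (hX : ∀ θ ∈ Icc a b, HasDerivAt X (X' θ) θ) : ContinuousOn X (Icc a b) :=
  fun θ hθ => (hX θ hθ).continuousAt.continuousWithinAt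

/-- CONVEXITY OF THE ENERGY IN `α` FOR A FIXED ADMISSIBLE TRIAL FUNCTION (`X` differentiable on `[a, b]`,
`X′ ∈ L²`): `W((1 − t)α₁ + tα₂) ≤ (1 − t)W(α₁) + tW(α₂)` for `0 ≤ t ≤ 1` — the correction term
`t(1 − t)(α₁ − α₂)²∫ sin²θ (X′² + X²) ≥ 0` is dropped. [cite: Freidberg2014, §12.3 eq. (12.38)] (its `α`-dependence;
cf. [Fundamenski2009] eq. (4.158)) -/
theorem energy_le_convexComb {s α₁ α₂ t a b : ℝ} {X X' : ℝ → ℝ} (hab : a ≤ b) (ht0 : 0 ≤ t) (ht1 : t ≤ 1)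
    (hX : ∀ θ ∈ Icc a b, HasDerivAt X (X' θ) θ)
    (hi : IntervalIntegrable (fun θ => X' θ ^ 2) volume a b) :
    energy s ((1 - t) * α₁ + t * α₂) X X' a b
      ≤ (1 - t) * energy s α₁ X X' a b + t * energy s α₂ X X' a b := by
  have h1 : IntervalIntegrable (energyDensity s α₁ X X') volume a b := intervalIntegrable_energyDensity hab hX hi
  have h2 : IntervalIntegrable (energyDensity s α₂ X X') volume a b := intervalIntegrable_energyDensity hab hX hi
  -- the correction integrand `sin²θ (X'² + X²)` is integrable and non-negative
  have hXc := continuousOn_of_hasDerivAt'' hX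
  have hq : IntervalIntegrable (fun θ => Real.sin θ ^ 2 * (X' θ ^ 2 + X θ ^ 2)) volume a b := by
    have hX2 : IntervalIntegrable (fun θ => X θ ^ 2) volume a b :=
      ContinuousOn.intervalIntegrable_of_Icc hab (hXc.pow 2)
    exact (hi.add hX2).continuousOn_mul ((Real.continuous_sin.pow 2).continuousOn)
  have hqnn : 0 ≤ ∫ θ in a..b, Real.sin θ ^ 2 * (X' θ ^ 2 + X θ ^ 2) :=
    intervalIntegral.integral_nonneg hab (fun θ _ => by positivity)
  have hcoef : 0 ≤ t * (1 - t) * (α₁ - α₂) ^ 2 := by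
    have : 0 ≤ 1 - t := by linarith
    positivity
  -- integrate the identity
  have e : energy s ((1 - t) * α₁ + t * α₂) X X' a b
      = (1 - t) * energy s α₁ X X' a b + t * energy s α₂ X X' a b
        - t * (1 - t) * (α₁ - α₂) ^ 2 * ∫ θ in a..b, Real.sin θ ^ 2 * (X' θ ^ 2 + X θ ^ 2) := by
    unfold energy
    rw [← intervalIntegral.integral_const_mul, ← intervalIntegral.integral_const_mul,
      ← intervalIntegral.integral_const_mul,
      ← intervalIntegral.integral_add (h1.const_mul _) (h2.const_mul _),
      ← intervalIntegral.integral_sub ((h1.const_mul _).add (h2.const_mul _)) (hq.const_mul _)]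
    apply intervalIntegral.integral_congr
    intro θ _
    simp only [energyDensity_convexComb]
  rw [e]
  nlinarith [mul_nonneg hcoef hqnn]

/-- ★ **THE WITNESS SET OF A TRIAL FUNCTION IN `α` IS AN INTERVAL**: if the same pair `(X, X′)` is an `s–α`
instability witness on the window `[a, b]` at `α₁` and at `α₂`, then it is one at EVERY `α ∈ [α₁, α₂]` (the energy,
a convex quadratic in `α`, is negative between two points where it is negative).  Two kernel certificates with one
trial function therefore certify that the whole band `{s} × [α₁, α₂]` of model surfaces is ballooning-unstable in
the model's one-surface sense. [cite: Freidberg2014, §12.3 eqs. (12.38)–(12.40)] («find an `X` … with `W̄ < 0` … The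
plasma is unstable», for every `α` of the band) -/
theorem unstableWitness_between {s α₁ α₂ α a b : ℝ} {X X' : ℝ → ℝ}
    (h₁ : UnstableWitness s α₁ a b X X') (h₂ : UnstableWitness s α₂ a b X X')
    (hα₁ : α₁ ≤ α) (hα₂ : α ≤ α₂) : UnstableWitness s α a b X X' := by
  obtain ⟨hab, hXu, ha, hb, hW₁⟩ := h₁
  obtain ⟨-, -, -, -, hW₂⟩ := h₂
  refine ⟨hab, hXu, ha, hb, ?_⟩
  have hX : ∀ θ ∈ Icc a b, HasDerivAt X (X' θ) θ := by rw [← uIcc_of_le hab.le]; exact hXu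
  -- `W(α₁) < 0` forces integrability of the density at `α₁`, hence `X′ ∈ L²`
  have hi : IntervalIntegrable (fun θ => X' θ ^ 2) volume a b := by
    by_contra hni
    have hnd : ¬ IntervalIntegrable (energyDensity s α₁ X X') volume a b :=
      fun hc => hni (intervalIntegrable_sq_of_energyDensity hab.le hX hc)
    have h0 : energy s α₁ X X' a b = 0 := by
      unfold energy; exact intervalIntegral.integral_undef hnd
    linarith
  rcases eq_or_lt_of_le (hα₁.trans hα₂) with heq | hlt
  · -- `α₁ = α₂ = α`
    have : α = α₁ := le_antisymm (heq ▸ hα₂) hα₁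
    rw [this]; exact hW₁
  · -- `α = (1 − t)α₁ + tα₂` with `t = (α − α₁)/(α₂ − α₁) ∈ [0, 1]`
    set t : ℝ := (α - α₁) / (α₂ - α₁) with ht
    have hd : 0 < α₂ - α₁ := by linarith
    have ht0 : 0 ≤ t := by rw [ht]; exact div_nonneg (by linarith) hd.le
    have ht1 : t ≤ 1 := by rw [ht, div_le_one hd]; linarith
    have hαt : α = (1 - t) * α₁ + t * α₂ := by
      rw [ht]; field_simp; ring
    have hconv := energy_le_convexComb hab.le ht0 ht1 hX hi (s := s) (α₁ := α₁) (α₂ := α₂)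
    rw [← hαt] at hconv
    have : (1 - t) * energy s α₁ X X' a b + t * energy s α₂ X X' a b < 0 := by
      rcases eq_or_lt_of_le ht0 with h0 | hpos
      · rw [← h0]; simpa using hW₁
      · have h1t : 0 ≤ 1 - t := by linarith
        nlinarith [mul_nonneg h1t (le_of_lt (neg_pos.mpr hW₁))]
    linarith

/-- Band form: two certificates with one trial function ⇒ every surface of the band is unstable in the model.
[cite: Freidberg2014, §12.3 eqs. (12.38)–(12.40)] -/
theorem unstableWitness_of_mem_Icc {s α₁ α₂ a b : ℝ} {X X' : ℝ → ℝ}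
    (h₁ : UnstableWitness s α₁ a b X X') (h₂ : UnstableWitness s α₂ a b X X') :
    ∀ α ∈ Icc α₁ α₂, UnstableWitness s α a b X X' :=
  fun _ hα => unstableWitness_between h₁ h₂ hα.1 hα.2

/-! ## §2 The same in the SHEAR direction: the energy of a fixed trial function is a convex quadratic in `s` at
fixed `α` (leading coefficient `θ² X′²` from `Λ² = (sθ − α sin θ)²`), so witness sets are intervals in `s` too -/

/-- THE `s–α` ENERGY DENSITY IS A CONVEX QUADRATIC IN THE SHEAR `s` (ring identity): at `s = (1 − t)s₁ + ts₂`,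
`density(s) = (1 − t)·density(s₁) + t·density(s₂) − t(1 − t)(s₁ − s₂)²·θ²·X′²`; the drive is affine in `s`, the
leading coefficient `θ² X′(θ)²` comes from the line bending. [cite: Freidberg2014, §12.6.2 eq. (12.97)] (structure of its
quadratic form in `s`; cf. [Fundamenski2009] eq. (4.158), quadratic in `s`) -/
theorem energyDensity_convexComb_shear (s₁ s₂ α t : ℝ) (X X' : ℝ → ℝ) (θ : ℝ) :
    energyDensity ((1 - t) * s₁ + t * s₂) α X X' θ
      = (1 - t) * energyDensity s₁ α X X' θ + t * energyDensity s₂ α X X' θ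
        - t * (1 - t) * (s₁ - s₂) ^ 2 * (θ ^ 2 * X' θ ^ 2) := by
  unfold energyDensity bending drive shearParam
  ring

/-- CONVEXITY OF THE ENERGY IN THE SHEAR for a fixed admissible trial function:
`W((1 − t)s₁ + ts₂) ≤ (1 − t)W(s₁) + tW(s₂)` for `0 ≤ t ≤ 1`. [cite: Freidberg2014, §12.3 eq. (12.38)] (its `s`-dependence) -/
theorem energy_le_convexComb_shear {s₁ s₂ α t a b : ℝ} {X X' : ℝ → ℝ} (hab : a ≤ b) (ht0 : 0 ≤ t) (ht1 : t ≤ 1)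
    (hX : ∀ θ ∈ Icc a b, HasDerivAt X (X' θ) θ)
    (hi : IntervalIntegrable (fun θ => X' θ ^ 2) volume a b) :
    energy ((1 - t) * s₁ + t * s₂) α X X' a b
      ≤ (1 - t) * energy s₁ α X X' a b + t * energy s₂ α X X' a b := by
  have h1 : IntervalIntegrable (energyDensity s₁ α X X') volume a b := intervalIntegrable_energyDensity hab hX hi
  have h2 : IntervalIntegrable (energyDensity s₂ α X X') volume a b := intervalIntegrable_energyDensity hab hX hi
  have hq : IntervalIntegrable (fun θ => θ ^ 2 * X' θ ^ 2) volume a b :=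
    hi.continuousOn_mul ((continuous_id.pow 2).continuousOn)
  have hqnn : 0 ≤ ∫ θ in a..b, θ ^ 2 * X' θ ^ 2 :=
    intervalIntegral.integral_nonneg hab (fun θ _ => by positivity)
  have hcoef : 0 ≤ t * (1 - t) * (s₁ - s₂) ^ 2 := by
    have : 0 ≤ 1 - t := by linarith
    positivity
  have e : energy ((1 - t) * s₁ + t * s₂) α X X' a b
      = (1 - t) * energy s₁ α X X' a b + t * energy s₂ α X X' a b
        - t * (1 - t) * (s₁ - s₂) ^ 2 * ∫ θ in a..b, θ ^ 2 * X' θ ^ 2 := by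
    unfold energy
    rw [← intervalIntegral.integral_const_mul, ← intervalIntegral.integral_const_mul,
      ← intervalIntegral.integral_const_mul,
      ← intervalIntegral.integral_add (h1.const_mul _) (h2.const_mul _),
      ← intervalIntegral.integral_sub ((h1.const_mul _).add (h2.const_mul _)) (hq.const_mul _)]
    apply intervalIntegral.integral_congr
    intro θ _
    simp only [energyDensity_convexComb_shear]
  rw [e]
  nlinarith [mul_nonneg hcoef hqnn]

/-- ★ THE WITNESS SET OF A TRIAL FUNCTION IN THE SHEAR IS AN INTERVAL: the same `(X, X′)` a witness on `[a, b]` at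
`(s₁, α)` and at `(s₂, α)` ⇒ at every `(s, α)` with `s ∈ [s₁, s₂]` — two certificates with one trial function give a
statement UNIFORM IN `s` on an interval. [cite: Freidberg2014, §12.3 eqs. (12.38)–(12.40)] -/
theorem unstableWitness_between_shear {s₁ s₂ s α a b : ℝ} {X X' : ℝ → ℝ}
    (h₁ : UnstableWitness s₁ α a b X X') (h₂ : UnstableWitness s₂ α a b X X')
    (hs₁ : s₁ ≤ s) (hs₂ : s ≤ s₂) : UnstableWitness s α a b X X' := by
  obtain ⟨hab, hXu, ha, hb, hW₁⟩ := h₁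
  obtain ⟨-, -, -, -, hW₂⟩ := h₂
  refine ⟨hab, hXu, ha, hb, ?_⟩
  have hX : ∀ θ ∈ Icc a b, HasDerivAt X (X' θ) θ := by rw [← uIcc_of_le hab.le]; exact hXu
  have hi : IntervalIntegrable (fun θ => X' θ ^ 2) volume a b := by
    by_contra hni
    have hnd : ¬ IntervalIntegrable (energyDensity s₁ α X X') volume a b :=
      fun hc => hni (intervalIntegrable_sq_of_energyDensity hab.le hX hc)
    have h0 : energy s₁ α X X' a b = 0 := by
      unfold energy; exact intervalIntegral.integral_undef hnd
    linarith
  rcases eq_or_lt_of_le (hs₁.trans hs₂) with heq | hlt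
  · have : s = s₁ := le_antisymm (heq ▸ hs₂) hs₁
    rw [this]; exact hW₁
  · set t : ℝ := (s - s₁) / (s₂ - s₁) with ht
    have hd : 0 < s₂ - s₁ := by linarith
    have ht0 : 0 ≤ t := by rw [ht]; exact div_nonneg (by linarith) hd.le
    have ht1 : t ≤ 1 := by rw [ht, div_le_one hd]; linarith
    have hst : s = (1 - t) * s₁ + t * s₂ := by
      rw [ht]; field_simp; ring
    have hconv := energy_le_convexComb_shear hab.le ht0 ht1 hX hi (s₁ := s₁) (s₂ := s₂) (α := α)
    rw [← hst] at hconv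
    have : (1 - t) * energy s₁ α X X' a b + t * energy s₂ α X X' a b < 0 := by
      rcases eq_or_lt_of_le ht0 with h0 | hpos
      · rw [← h0]; simpa using hW₁
      · have h1t : 0 ≤ 1 - t := by linarith
        nlinarith [mul_nonneg h1t (le_of_lt (neg_pos.mpr hW₁))]
    linarith

/-- Rectangle-edge form: one trial function certified at the two corners `(s₁, α)` and `(s₂, α)` is a witness on the
whole horizontal edge. [cite: Freidberg2014, §12.3 eqs. (12.38)–(12.40)] -/
theorem unstableWitness_of_mem_Icc_shear {s₁ s₂ α a b : ℝ} {X X' : ℝ → ℝ}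
    (h₁ : UnstableWitness s₁ α a b X X') (h₂ : UnstableWitness s₂ α a b X X') :
    ∀ s ∈ Icc s₁ s₂, UnstableWitness s α a b X X' :=
  fun _ hs => unstableWitness_between_shear h₁ h₂ hs.1 hs.2

end SAlpha

end Ballooning

end Literature.MathematicalPhysics.MHD

end
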